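import Summits.RiemannHypothesis.RiemannHypothesis.Theorems.ThetaTier2RowSound
import HarnessLib

/-!
# THETA tier-2 kernel rows — twin primes `4157 ≤ q ≤ 4799` (module 7 of 13; cc-s2-1, WEIL typing lane; RH-FREE bookkeeping)

Data module of the tier-2 theta certificate (THETA-CERT-cc6 §E; HOME/cc-s2-1/gen22/TIER2-KERNEL-SPEC.md; soundness chain
`ThetaTier2Check … ThetaTier2RowSound`): the rows `(q, q⁺, m, δ·10¹², menu, k)` — `m = 5`, `δ = ⌊0.98·δ_q·10¹²⌋/10¹²` with
`δ_q = ½ log(q⁺/q)`, menu `0` = thin seed `(1/20, 19/20, 1)`, `η′ = 1/100` (menu `1` = `(1/4, 3/5, 1)`, `η′ = 1/20` for `q = 179, 191`),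
`t₀ = 2⁻¹⁵`; `K = 6`, `τ = 1/100`, `D = 3`, `W_l = 4`, `J = 64` — for the twin primes `4157 ≤ q ≤ 4799` in the range of the route item
`stmt-RiemannHypothesis-19172` (`WallsTenKTwin`, `route-RiemannHypothesis-WeilSemilocal`), checked in the kernel by `Row2.check`
(`decide +kernel`, ≈ 14 s per row), and the resulting REAL statements `T2Valid r.inp r.real ∧ r.RowFacts` (`Row2.check_sound`) that the
E-side assembly turns into `UC(q)`.  Nothing here bears on the truth of RH.
-/

set_option linter.dupNamespace false  -- the mandated namespace repeats `RiemannHypothesis`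

namespace Summit.RiemannHypothesis.RiemannHypothesis.Theorems.ThetaTier2

/-- Twin rows `4157 ≤ q ≤ 4421` (8 rows). [this cell, TIER2-KERNEL-SPEC §4] -/
def twinRows07_1 : List Row2 := [
  ⟨4157, 4159, 5, 235690240, 0, 15⟩, ⟨4217, 4219, 5, 232337605, 0, 15⟩, ⟨4229, 4231, 5, 231678491, 0, 15⟩, ⟨4241, 4243, 5, 231023106, 0, 15⟩,
  ⟨4259, 4261, 5, 230046952, 0, 15⟩, ⟨4271, 4273, 5, 229400753, 0, 15⟩, ⟨4337, 4339, 5, 225910561, 0, 15⟩, ⟨4421, 4423, 5, 221619180, 0, 15⟩ ]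

/-- The kernel verdict for `twinRows07_1`. [this cell, THETA-CERT-cc6 §E6] -/
theorem twinRows07_1_check : twinRows07_1.all Row2.check = true := by
  decide +kernel

/-- (K1)–(K7) and the row facts at every row of `twinRows07_1`. [this cell, THETA-CERT-cc6 §E6] -/
theorem twinRows07_1_valid : ∀ r ∈ twinRows07_1, T2Valid r.inp r.real ∧ r.RowFacts :=
  fun r hr => r.check_sound (List.all_eq_true.1 twinRows07_1_check r hr)

/-- Twin rows `4481 ≤ q ≤ 4799` (8 rows). [this cell, TIER2-KERNEL-SPEC §4] -/
def twinRows07_2 : List Row2 := [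
  ⟨4481, 4483, 5, 218652390, 0, 15⟩, ⟨4517, 4519, 5, 216910140, 0, 15⟩, ⟨4547, 4549, 5, 215479335, 0, 15⟩, ⟨4637, 4639, 5, 211297976, 0, 15⟩,
  ⟨4649, 4651, 5, 210752691, 0, 15⟩, ⟨4721, 4723, 5, 207539181, 0, 15⟩, ⟨4787, 4789, 5, 204678365, 0, 15⟩, ⟨4799, 4801, 5, 204166669, 0, 15⟩ ]

/-- The kernel verdict for `twinRows07_2`. [this cell, THETA-CERT-cc6 §E6] -/
theorem twinRows07_2_check : twinRows07_2.all Row2.check = true := by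
  decide +kernel

/-- (K1)–(K7) and the row facts at every row of `twinRows07_2`. [this cell, THETA-CERT-cc6 §E6] -/
theorem twinRows07_2_valid : ∀ r ∈ twinRows07_2, T2Valid r.inp r.real ∧ r.RowFacts :=
  fun r hr => r.check_sound (List.all_eq_true.1 twinRows07_2_check r hr)

end Summit.RiemannHypothesis.RiemannHypothesis.Theorems.ThetaTier2
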